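import Literature.AlgebraicGeometry.Frobenioids.PiNatPerfFactorialWeak
import Literature.AnabelianGeometry.EtaleTheta.RealificationCoordinates
import Literature.AnabelianGeometry.EtaleTheta.PerfectionPrimes

/-!
# `∏_J ℤ≥0`: the perfection is COFINAL in the (weak) realification

Mochizuki, *The geometry of Frobenioids I*, Kyushu J. Math. **62** (2008), Def. 2.4 (i), kurims pp.47–48
[cite: MochizukiFrdI2008, Def. 2.4(i) p.48] (the realification `M^rlf`); Mochizuki, *The étale theta
function …*, Publ. RIMS **45** (2009), proof of Lemma 3.5, PDF p.75 [cite: MochizukiEtTh2009, Lem 3.5 p.75]: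
"it follows from the definition of the realification … that for every `a ∈ P^rlf`, there exists an
`a' ∈ P^pf` such that `a' ≥ a`."

abc-iut cell, F-L2d2-1 repair chain (seat abc-iut-L2-d2).  For the WEAK notion of perf-factorial monoid
adopted by the cell ((d_ord) + (d_res) in place of Def. 2.4 (i)(d), `PerfFactorialWeak.lean`) the quoted
cofinality is NOT automatic (it fails for the weakly perf-factorial monoid of BOUNDED functions
`ℕ → ℤ≥0`), and it is exactly the extra hypothesis `hcof` under which the cell's weak Lemma 3.5 engine
(`RealificationOrderWeak.lean`, `RealificationExtensionWeak.lean`, `Discharge/Sec3Lemma35RlfWeak.lean`)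
proves [EtTh] Lemma 3.5.  THIS FILE discharges `hcof` for the intended model `∏_J ℤ≥0 = Multiplicative
(J → ℕ)` of `DIV⁺(Z_∞^log)` ([EtTh] Prop. 3.2 (i)): every element of `(∏_J ℤ≥0)^rlf` lies below the image
of an element of `∏_J ℤ≥0` itself (`PiNat.rlf_cofinal`) — because EVERY integral pattern is a
factorization there ((d♮), `PiNat.exists_factorMap_eq_of_integral`).  Proof-only.  HONEST FRAMING:
classical monoid algebra; nothing here bears on [IUTchIII] Cor. 3.12.
-/

namespace Literature.AlgebraicGeometry.Frobenioids

namespace PiNat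

open Function Literature.AnabelianGeometry.EtaleTheta

universe u

variable {J : Type u} [DecidableEq J]

/-- At each prime `𝔮 = 𝔮_j` of `(∏_J ℤ≥0)^pf`, every element of `M^rlf_𝔮 ≅ ℝ≥0` lies below the image of an
INTEGRAL element `e_j^k ∈ M^pf_𝔮`. [cite: MochizukiFrdI2008, Def. 2.4(i) p.47] -/
theorem exists_integral_ge (𝔮 : Primes (Perfection (Multiplicative (J → ℕ))))
    (r : RlfAt (Multiplicative (J → ℕ)) 𝔮) :
    ∃ z : PfAt (Multiplicative (J → ℕ)) 𝔮,
      (z : Perfection (Multiplicative (J → ℕ))) ∈ MonoidHom.mrange (Perfection.of (Multiplicative (J → ℕ))) ∧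
        r ∣ Realification.of _ z := by
  have hmono : IsMonoprime (PfAt (Multiplicative (J → ℕ)) 𝔮) := isMonoprime_pfAt 𝔮
  obtain ⟨f⟩ := RealificationCoord.nonempty_coord hmono
  -- a (possibly fractional) element of `M^pf_𝔮` above `r`
  obtain ⟨y, hy⟩ := RealificationCoord.exists_coord_ge f hmono (Multiplicative.toAdd (f r))
  -- `y = (e_j^k)^{1/n}`; its `n`-th power `e_j^k` is integral and still above `r`
  obtain ⟨j, rfl⟩ := exists_eq_q 𝔮
  obtain ⟨k, n, hkn⟩ := mem_submonoid_q_iff.1 y.2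
  have hpow : ((y ^ (n : ℕ) : PfAt (Multiplicative (J → ℕ)) (q j)) : Perfection (Multiplicative (J → ℕ))) =
      Perfection.of _ (single j k) := by
    rw [SubmonoidClass.coe_pow, hkn, Perfection.mk_pow_self]
  refine ⟨y ^ (n : ℕ), ⟨single j k, hpow.symm⟩, ?_⟩
  have hry : r ∣ Realification.of _ y := by
    have h := (RealificationCoord.mnnreal_dvd_iff_le (f r) (f (Realification.of _ y))).2 hy
    simpa only [MulEquiv.symm_apply_apply] using map_dvd f.symm h
  exact hry.trans (map_dvd (Realification.of _) (dvd_pow_self y n.ne_zero))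

/-- **Cofinality of `(∏_J ℤ≥0)^pf` — indeed of `∏_J ℤ≥0` — in `(∏_J ℤ≥0)^rlf`** ("for every `a ∈ P^rlf`,
there exists an `a' ∈ P^pf` such that `a' ≥ a`", [EtTh] p. 75, for this monoid): every element of the weak
realification is bounded above by the image of an element of `∏_J ℤ≥0`.  This is the hypothesis `hcof`
of the cell's weak Lemma 3.5 engine, DISCHARGED for the model of `DIV⁺(Z_∞^log)`.
[cite: MochizukiEtTh2009, Lem 3.5 p.75] -/
theorem rlf_cofinal (x : (isPerfFactorialWeak (J := J)).Rlf) :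
    ∃ g : Multiplicative (J → ℕ),
      x ∣ (isPerfFactorialWeak (J := J)).toRealification (Perfection.of _ g) := by
  choose z hz using fun 𝔮 => exists_integral_ge 𝔮 (x.1 𝔮)
  obtain ⟨g, hg⟩ := exists_factorMap_eq_of_integral z fun 𝔮 => (hz 𝔮).1
  refine ⟨g, ?_⟩
  -- divisibility in `M^rlf ⊆ M^rlf_factor` is componentwise, the quotient having admissible support
  choose t ht using fun 𝔮 => (hz 𝔮).2
  have hval : ((isPerfFactorialWeak (J := J)).toRealification (Perfection.of _ g) :
      RlfFactor (Multiplicative (J → ℕ))) = x.1 * fun 𝔮 => t 𝔮 := by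
    funext 𝔮
    change factorMap (Multiplicative (J → ℕ)) (Perfection.of _ g) 𝔮 = x.1 𝔮 * t 𝔮
    rw [hg, pfFactorToRlfFactor_apply]
    exact ht 𝔮
  have htmem : (fun 𝔮 => t 𝔮) ∈ (isPerfFactorialWeak (J := J)).realification := by
    refine ⟨Perfection.of _ g, fun 𝔮 h𝔮 => ?_⟩
    have hsub := supp_subset_supp_mul (fun 𝔮 => t 𝔮) x.1 h𝔮
    rw [mul_comm, ← hval] at hsub
    exact hsub
  exact ⟨⟨fun 𝔮 => t 𝔮, htmem⟩, Subtype.ext hval⟩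

omit [DecidableEq J] in
/-- The same for the instance-free packaging `isPerfFactorialWeak'`. [cite: MochizukiEtTh2009, Lem 3.5 p.75] -/
theorem rlf_cofinal' (x : (isPerfFactorialWeak' (J := J)).Rlf) :
    ∃ b : Perfection (Multiplicative (J → ℕ)), x ∣ (isPerfFactorialWeak' (J := J)).toRealification b := by
  classical
  obtain ⟨g, hg⟩ := rlf_cofinal (J := J) x
  exact ⟨Perfection.of _ g, hg⟩

end PiNat

end Literature.AlgebraicGeometry.Frobenioids
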